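import Summits.QuantumFields.BalabanUV.Beta.BorderedHessianSymmetry
import Literature.MathematicalPhysics.QuantumFieldTheory.Balaban1983to89.Beta.KernelReflection

/-!
# `BalabanUV.Beta.SecondOrderBorderParity` — binder row D1, (L4): **THE PARITY CONSTRAINT OF THE BORDER LETTER** — a kernel fact about the
# END's border socket `hBfm`/`hBmf` (owner NOTE X-an2-46): with a TWIN-symmetric border table (parity-ODD, e.g. any `packVH` packing such as
# an1's `vh₂SAt`) and a parity-odd residual `RB`, the two border blocks of the letter force the similarity kernel `C` to be TWIN on the border
# (`C x z (inl β) (inr m) = C z x (inr m) (inl β)`); with an ANTI-twin (parity-EVEN) border table they force `RB = −(twin part of C)` on the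
# border, i.e. the letter holds EXACTLY with the anti-twin part of `C` and NO junk (β sub-cell, row BETA-an2 = BINDER-OWNERS row D1 OWNER,
# lineage an2 gen 19)

HONEST FRAMING (cell charter, verbatim): «discharging BetaPertH makes Balaban's UV stability UNCONDITIONAL — a real
constructive-QFT result; it is NOT the continuum limit and NOT the Clay problem.»  Neutral kernel algebra ([folklore]), entrywise; no statement of
Bałaban's papers, no `[cite:]`, no `def`, no `Prop` fact; instantiates no binder of the wall.  NOT D1, NOT `BetaPertH`, NOT continuum, NOT Clay.

WHY IT MATTERS (reading; asserted nowhere in the kernel beyond the two theorems): in `SpineRooted.…_of_letters_final` the border letter is the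
pair (hBfm)/(hBmf) with ONE similarity kernel `C := conjW 𝕄_j (S κ u) (S κ′ u′) X X′ (X∘X′)` and ONE residual `RB` required row-parity-odd.
`conjW₁ S S′ X X′` is ANTI-twin on the border when `S`, `S′` are twin there (the wall's `SpureRecAt` IS: `trK_SpureRecAt`), so by
`twin_of_border_letter` a twin `vh₂S` (an1's `vh₂SAt := packVH …`) can satisfy the socket only if that anti-twin part vanishes identically —
it does not (entry `x = u`, `β = κ = α`, `m ≠ α`: `cVH · vhSAt κ′ u′ (u, α; z, m) · γ ≠ 0`).  The border table of the wall's second-order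
letter must therefore be packed ANTI-twin (parity-EVEN — the `(a,b)`-SYMMETRIC colour structure of the `(c,c′)`-symmetrised second-order jet
strips to an anti-twin table, exactly as the antisymmetric `f^{abc}` of the first order strips to the twin `vhSAt`), and then
`rb_eq_of_antiTwin_border_letter` says the letter is EXACT: `RB|border = −Tw(C)` (`= 0` for the canonical second symbol).
Provenance: β sub-cell, unit beta-an2 gen 19, 2026-08-20 (v1); no existing file touched.
-/

open Literature.MathematicalPhysics.QuantumFieldTheory.Balaban1983to89
open Literature.MathematicalPhysics.QuantumFieldTheory.Balaban1983to89.Beta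
open ExpKernelCalculus (MKer)
open KernelReflection (LegMap refK refK_apply)
open OneStepResolventKernel (Fib)
open Summit.QuantumFields.BalabanUV.Beta.TameKernelCalculus
open Summit.QuantumFields.BalabanUV.Beta.BorderedHessian (sgnK sgnK_apply sgnF_inl sgnF_inr)

namespace Summit.QuantumFields.BalabanUV.Beta.SecondOrderBorderParity

noncomputable section

variable {d : ℕ}

/-- [folklore] **RELABELLING AND TRANSPOSITION COMMUTE**: `refK Φ K z x b a = refK Φ (trK K) x z a b`. -/
theorem refK_swap (Φ : LegMap (d + 1) (Fib d)) (K : MKer (d + 1) (Fib d)) (x z : Fin (d + 1) → ℤ) (a b : Fib d) :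
    refK Φ K z x b a = refK Φ (trK K) x z a b := by
  rw [refK_apply, refK_apply, trK_apply, mul_comm (Φ.s b)]

/-- [folklore] A row-parity-odd kernel is TWIN on the border blocks: `RB z x (inr m) (inl β) = RB x z (inl β) (inr m)`. -/
theorem twin_of_parityOdd {RB : MKer (d + 1) (Fib d)} (h : trK RB = -sgnK RB) (x z : Fin (d + 1) → ℤ) (β m : Fin (d + 1)) :
    RB z x (Sum.inr m) (Sum.inl β) = RB x z (Sum.inl β) (Sum.inr m) := by
  have e := congrFun (congrFun (congrFun (congrFun h x) z) (Sum.inl β)) (Sum.inr m)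
  rw [trK_apply, Pi.neg_apply, Pi.neg_apply, Pi.neg_apply, Pi.neg_apply, sgnK_apply, sgnF_inl, sgnF_inr] at e
  linarith

section Letter

variable {Φ : LegMap (d + 1) (Fib d)} {B₁ B₀ C RB : MKer (d + 1) (Fib d)} {b c : ℝ}

/-- [folklore] **A TWIN BORDER TABLE FORCES A TWIN SIMILARITY KERNEL.**  If the reflected table `B₁` and the table `B₀` are twin-symmetric
on the border, the residual `RB` is row-parity-odd, `c ≠ 0`, and both border blocks of the letter
`(b • B₁) =fm,mf= c • refK Φ (b • B₀ + C + RB)` hold, then `C` is twin on the border. -/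
theorem twin_of_border_letter (hc : c ≠ 0)
    (hB₁ : ∀ (x z : Fin (d + 1) → ℤ) (β m : Fin (d + 1)), B₁ z x (Sum.inr m) (Sum.inl β) = B₁ x z (Sum.inl β) (Sum.inr m))
    (hB₀ : ∀ (x z : Fin (d + 1) → ℤ) (β m : Fin (d + 1)), B₀ z x (Sum.inr m) (Sum.inl β) = B₀ x z (Sum.inl β) (Sum.inr m))
    (hRB : trK RB = -sgnK RB)
    (hfm : ∀ (x z : Fin (d + 1) → ℤ) (β m : Fin (d + 1)),
      (b • B₁) x z (Sum.inl β) (Sum.inr m) = (c • refK Φ (b • B₀ + C + RB)) x z (Sum.inl β) (Sum.inr m))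
    (hmf : ∀ (x z : Fin (d + 1) → ℤ) (m β : Fin (d + 1)),
      (b • B₁) x z (Sum.inr m) (Sum.inl β) = (c • refK Φ (b • B₀ + C + RB)) x z (Sum.inr m) (Sum.inl β))
    (x z : Fin (d + 1) → ℤ) (β m : Fin (d + 1)) :
    C z x (Sum.inr m) (Sum.inl β) = C x z (Sum.inl β) (Sum.inr m) := by
  -- read the two blocks at the PRE-IMAGES of `(x, z)` under the leg bijections, so that `refK` evaluates `K` at `(x, z)` itself
  set x' : Fin (d + 1) → ℤ := (Φ.r (Sum.inl β)).symm x with hx'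
  set z' : Fin (d + 1) → ℤ := (Φ.r (Sum.inr m)).symm z with hz'
  have ex : Φ.r (Sum.inl β) x' = x := by rw [hx']; exact Equiv.apply_symm_apply _ _
  have ez : Φ.r (Sum.inr m) z' = z := by rw [hz']; exact Equiv.apply_symm_apply _ _
  have h1 := hfm x' z' β m
  have h2 := hmf z' x' m β
  simp only [Pi.smul_apply, Pi.add_apply, smul_eq_mul, refK_apply, ex, ez] at h1 h2
  rw [hB₁ x' z' β m] at h2
  have hs : Φ.s (Sum.inl β) * Φ.s (Sum.inr m) ≠ 0 := by
    intro h0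
    have := congrArg (fun t => t * (Φ.s (Sum.inl β) * Φ.s (Sum.inr m))) h0
    simp only [zero_mul] at this
    have h3 : Φ.s (Sum.inl β) * Φ.s (Sum.inl β) * (Φ.s (Sum.inr m) * Φ.s (Sum.inr m)) = 0 := by
      calc _ = Φ.s (Sum.inl β) * Φ.s (Sum.inr m) * (Φ.s (Sum.inl β) * Φ.s (Sum.inr m)) := by ring
        _ = 0 := this
    rw [Φ.s_mul_s, Φ.s_mul_s, one_mul] at h3
    exact one_ne_zero h3
  have e : c * (Φ.s (Sum.inl β) * Φ.s (Sum.inr m)) *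
      ((b * B₀ x z (Sum.inl β) (Sum.inr m) + C x z (Sum.inl β) (Sum.inr m) + RB x z (Sum.inl β) (Sum.inr m)) -
        (b * B₀ z x (Sum.inr m) (Sum.inl β) + C z x (Sum.inr m) (Sum.inl β) + RB z x (Sum.inr m) (Sum.inl β))) = 0 := by
    have := h1.symm.trans h2
    rw [← sub_eq_zero] at this
    rw [← this]; ring
  rw [hB₀ x z β m, twin_of_parityOdd hRB x z β m] at e
  have e' := (mul_eq_zero.1 e).resolve_left (mul_ne_zero hc hs)
  linarith

/-- [folklore] **AN ANTI-TWIN BORDER TABLE MAKES THE LETTER EXACT.**  If `B₁`, `B₀` are ANTI-twin on the border (parity-even there), `RB` is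
row-parity-odd, `c ≠ 0`, and both border blocks of the letter hold, then the residual is FORCED: `RB =fm= −½ · (C + twin of C)`, i.e. minus
the twin part of `C`; in particular a similarity kernel that is anti-twin on the border (the canonical `conjW … (X∘X′)`) leaves `RB =border= 0`. -/
theorem rb_eq_of_antiTwin_border_letter (hc : c ≠ 0)
    (hB₁ : ∀ (x z : Fin (d + 1) → ℤ) (β m : Fin (d + 1)), B₁ z x (Sum.inr m) (Sum.inl β) = -B₁ x z (Sum.inl β) (Sum.inr m))
    (hB₀ : ∀ (x z : Fin (d + 1) → ℤ) (β m : Fin (d + 1)), B₀ z x (Sum.inr m) (Sum.inl β) = -B₀ x z (Sum.inl β) (Sum.inr m))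
    (hRB : trK RB = -sgnK RB)
    (hfm : ∀ (x z : Fin (d + 1) → ℤ) (β m : Fin (d + 1)),
      (b • B₁) x z (Sum.inl β) (Sum.inr m) = (c • refK Φ (b • B₀ + C + RB)) x z (Sum.inl β) (Sum.inr m))
    (hmf : ∀ (x z : Fin (d + 1) → ℤ) (m β : Fin (d + 1)),
      (b • B₁) x z (Sum.inr m) (Sum.inl β) = (c • refK Φ (b • B₀ + C + RB)) x z (Sum.inr m) (Sum.inl β))
    (x z : Fin (d + 1) → ℤ) (β m : Fin (d + 1)) :
    RB x z (Sum.inl β) (Sum.inr m) = -(1 / 2 : ℝ) * (C x z (Sum.inl β) (Sum.inr m) + C z x (Sum.inr m) (Sum.inl β)) := by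
  set x' : Fin (d + 1) → ℤ := (Φ.r (Sum.inl β)).symm x with hx'
  set z' : Fin (d + 1) → ℤ := (Φ.r (Sum.inr m)).symm z with hz'
  have ex : Φ.r (Sum.inl β) x' = x := by rw [hx']; exact Equiv.apply_symm_apply _ _
  have ez : Φ.r (Sum.inr m) z' = z := by rw [hz']; exact Equiv.apply_symm_apply _ _
  have h1 := hfm x' z' β m
  have h2 := hmf z' x' m β
  simp only [Pi.smul_apply, Pi.add_apply, smul_eq_mul, refK_apply, ex, ez] at h1 h2
  rw [hB₁ x' z' β m] at h2
  have hs : Φ.s (Sum.inl β) * Φ.s (Sum.inr m) ≠ 0 := by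
    intro h0
    have := congrArg (fun t => t * (Φ.s (Sum.inl β) * Φ.s (Sum.inr m))) h0
    simp only [zero_mul] at this
    have h3 : Φ.s (Sum.inl β) * Φ.s (Sum.inl β) * (Φ.s (Sum.inr m) * Φ.s (Sum.inr m)) = 0 := by
      calc _ = Φ.s (Sum.inl β) * Φ.s (Sum.inr m) * (Φ.s (Sum.inl β) * Φ.s (Sum.inr m)) := by ring
        _ = 0 := this
    rw [Φ.s_mul_s, Φ.s_mul_s, one_mul] at h3
    exact one_ne_zero h3
  have e : c * (Φ.s (Sum.inl β) * Φ.s (Sum.inr m)) *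
      ((b * B₀ x z (Sum.inl β) (Sum.inr m) + C x z (Sum.inl β) (Sum.inr m) + RB x z (Sum.inl β) (Sum.inr m)) +
        (b * B₀ z x (Sum.inr m) (Sum.inl β) + C z x (Sum.inr m) (Sum.inl β) + RB z x (Sum.inr m) (Sum.inl β))) = 0 := by
    have := h1.symm
    have h2' := h2
    -- `b B₁(x',z') fm = c…K(x,z)`, `-(b B₁(x',z') fm) = c…K(z,x) mf`
    have : c * (Φ.s (Sum.inl β) * Φ.s (Sum.inr m) *
        (b * B₀ x z (Sum.inl β) (Sum.inr m) + C x z (Sum.inl β) (Sum.inr m) + RB x z (Sum.inl β) (Sum.inr m))) +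
        c * (Φ.s (Sum.inr m) * Φ.s (Sum.inl β) *
          (b * B₀ z x (Sum.inr m) (Sum.inl β) + C z x (Sum.inr m) (Sum.inl β) + RB z x (Sum.inr m) (Sum.inl β))) = 0 := by
      rw [← h1, ← h2']; ring
    rw [← this]; ring
  rw [hB₀ x z β m, twin_of_parityOdd hRB x z β m] at e
  have e' := (mul_eq_zero.1 e).resolve_left (mul_ne_zero hc hs)
  linarith

end Letter

end

end Summit.QuantumFields.BalabanUV.Beta.SecondOrderBorderParity
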